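import Summits.BirchSwinnertonDyer.BirchSwinnertonDyer.Theorems.AdditiveBranchIMCGordTwoRankZeroOffCaseOneFieldSupplyR0
import Summits.BirchSwinnertonDyer.Rank1Residual.Additive.UnramifiedBaseChange
import Summits.BirchSwinnertonDyer.Rank1Residual.Additive.GordRankZeroChiBranch
import Literature.NumberTheory.EllipticCurves.FouquetWan2021.PPartBSDRankZeroAdditive
import HarnessLib

/-!
# Route `AdditiveBranchIMC`, crux `GordTwoRankZeroOffCaseOne` (19357): «DOOR F» — the (G-ord, `e = 2`) rank-0 cell on the Fouquet–Wan sub-row is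
# `MissingLowerBoundAt` MODULO THE TYPED PREPRINT READING wi-101363 `FouquetWan2021.cor110_missingLowerBoundAt_rankZero_additiveTwistType`
# (row vocabulary + glue; landed by the LEAD cruxlead-19357 g19 AFTER the door-D frame, per director-bsd (776)(iv) / (799)(i); `--supports` 19357,
# helper only; the 19357 / 19358 SKELETONS TAKE NO DOOR-F CASE — registries stay preprint-free, (799)(ii))

STATUS OF THE INPUT (director-bsd (776)(i) / (799)(i), verbatim): «PREPRINT arXiv:2107.13726, unrefereed; typed READING, not a Literature fact of
record» — Fouquet–Wan, «The Iwasawa Main Conjecture for modular motives», arXiv:2107.13726 (2021) Thm 1.1 / Cor 1.10; no journal record as of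
2026-08-31; Fouquet 2024 (Publ. Math. Besançon) states no published result covers additive reduction. The fact enters ONLY as the explicit hypothesis
`(hFW : ‹cor110…›) →` of the two glue theorems and is never consumed as if proved; rows closed through this file are booked ONLY in the SEPARATE census
column «r₀ modulo PREPRINT (door F)» ((776)(iii) / (799)(iii)), never merged into the r₀ % of record. Drafted by the pen (bsd-addord-plan g48, e26 r2,
tree draft `Cruxes/GordTwoRankZeroOffCaseOne/FouquetWanGlueDraft.lean` 0bbbc93456a2); bytes below = the draft.

Director-bsd (776)(A) 2026-08-31T08:05Z: the PREPRINT Fouquet–Wan, «The Iwasawa Main Conjecture for modular motives», arXiv:2107.13726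
(2021; no journal record as of 2026-08-31; Fouquet 2024, Publ. Math. Besançon doi:10.5802/pmb.54, states that no published result covers
additive reduction) Thm 1.1 / Cor 1.10 is ADMISSIBLE as a typed Literature READING under rails (i)–(v) (status verbatim in the docstring, debt
flagged `preprint`, rows booked in a SEPARATE column «r₀ modulo PREPRINT (door F)», typer order AFTER R2₂/R3₂/R4₂, LEAD glue after the door-D
frame). r2 CHANGES vs e23: (Langlands) is keyed LITERALLY to the landed fact's binder (every globally minimal GOOD-at-`p` twist model `V`, not only
the good-ordinary ones — all such `V` are isomorphic minimal models of `E^{(p*)}`, so nothing is lost), and the GLUE theorem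
`missingLowerBoundAt_rankZero_fouquetWan : ‹the fact› → ∀ W p, W.analyticRank = 0 → N10.CellGordTwo W p → FouquetWanRowR0 W p → MissingLowerBoundAt W p`
is PROVED (cell ⟹ `E` additive at the place over `p` by `Additive.hasAdditiveReductionAt_of_addv`; the good twist model by
`TypeGOrd.exists_goodOrd_pStar_twist_model`; the rest is the row). Row predicates, the conservative variant and the one-line comparisons with the
line vocabulary of record (`ThreeFieldRoadSupply.WanPrime`) as in e23. Dictionary and census: HOME
`planner/g2_3f_enlarge/e23/README.md` (06cef8db8f3b314a) §3–§4.

PRINT (arXiv:2107.13726 v3 p. 2, Thm 1.1): `p > 2`; `f ∈ S_k(Γ₀(N))` normalised eigencuspform, `k ≥ 2`; (irr) `ρ̄_f` absolutely irreducible;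
(Langlands) `(ρ̄_f|G_{ℚ_p})^ss ≠ χ ⊕ χ` and `≠ χ ⊕ χ·χ̄_cyc`; (Steinberg) `∃ ℓ ∤ p`, `ℓ ∥ N`, `dim ρ̄^{I_ℓ} = 1`, `dim ρ̄^{G_ℓ} = 0`. Cor 1.10 (p. 6):
for `A/ℚ` of GL₂-type with newform `f`, `L(A,1) ≠ 0`, `A[p]` as in Thm 1.1: `v_p(L(A,1)/Ω_f) = v_p(#Ш(A/ℚ)[p^∞]·∏_{q∣N} Tam_q(A/ℚ))`.

ON THE CELL (`E/ℚ` globally minimal `W`, `p ≥ 5`, `E` additive at `p`, potentially good with `e_p = 2`, so `W = C • V^{(p*)}` for a globally minimal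
`V` good ORDINARY at `p` — `TypeGOrd.exists_goodOrd_pStar_twist_model`): `(ρ̄_E|G_{ℚ_p})^ss = ω^{(p−1)/2}·(unr(α⁻¹)·χ̄_cyc ⊕ unr(α))` with
`α ≡ a_p(V) (mod p)` the unit root, so (Langlands) ⟺ `α² ≢ 1` ⟺ `a_p(V)² ≢ 1 (mod p)` (`LanglandsGenericAt`); at `ℓ ∥ N`, `ρ̄|G_ℓ` is the Tate
extension twisted by the unramified `δ_ℓ = ±1`, `dim ρ̄^{I_ℓ} = 1 ⟺ p ∤ v_ℓ(Δ_min)`, and then `ρ̄^{G_ℓ} = 0 ⟺ δ_ℓ·ℓ ≢ 1 (mod p)`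
(`SteinbergPrimeAt`, LITERAL reading; the authors' gloss «Steinberg twisted by the unramified character `ℓ ↦ (−1)ℓ^{k/2−1}`» = `a_ℓ = −1` =
NON-split gives the conservative `SteinbergPrimeNonsplitAt` = the line's `WanPrime` ∧ `p ∤ ℓ + 1`). (irr): an odd irreducible `ρ̄ : G_ℚ → GL₂(𝔽_p)`,
`p` odd, is absolutely irreducible (complex conjugation has distinct eigenvalues) — `Irr W p` suffices [folklore].

DEFINITIONS + three one-line comparison lemmas + TWO glue theorems (literal / conservative sub-row) whose only non-definitional input is the PREPRINT
fact as a HYPOTHESIS; nothing asserted about any curve unconditionally; no instance, no notation, no `sorry`. Rows closed through this file are booked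
ONLY in the separate census column «r₀ modulo PREPRINT (door F)» ((776)(iii)). BSD is proved for no curve by this file.

References: [FouquetWan2021] O. Fouquet, X. Wan, arXiv:2107.13726, Thm. 1.1 (p. 2), Cor. 1.10 (p. 6) — PREPRINT; [Fouquet2024PMB] O. Fouquet,
Publ. Math. Besançon 2024, doi:10.5802/pmb.54, Thm. 1.1 (p. 24); [SkinnerUrban2014] Thm. 3.6.4 (the ramification clause `p ∤ v_ℓ(Δ)`).
-/

set_option linter.dupNamespace false
set_option autoImplicit false

noncomputable section

open scoped Classical

open WeierstrassCurve Literature.NumberTheory.EllipticCurves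
  Literature.NumberTheory.EllipticCurves.Rank1Residual
  Literature.NumberTheory.EllipticCurves.Rank1Residual.Typed

open Summit.BirchSwinnertonDyer.Rank1Residual
open Summit.BirchSwinnertonDyer.Rank1Residual.Additive
open Summit.BirchSwinnertonDyer.BirchSwinnertonDyer.Theorems
open ThreeFieldRoadSupply
open IsDedekindDomain NumberField Rat.HeightOneSpectrum
open Literature.NumberTheory.EllipticCurves (FouquetWan2021.cor110_missingLowerBoundAt_rankZero_additiveTwistType)

namespace Summit.BirchSwinnertonDyer.BirchSwinnertonDyer.Theorems.FouquetWanRoad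

/-- **(Langlands) on the (G-ord, `e = 2`) cell** — Fouquet–Wan Thm 1.1's second hypothesis read on `E = C • V^{(p*)}`: for EVERY globally
minimal twist model `V` of `W` at `p* = (−1)^{(p−1)/2} p` with GOOD reduction at `p` (r2: keyed literally to the landed reading's binder; on the cell
every such `V` is good ORDINARY and all are isomorphic minimal models of `E^{(p*)}`), `a_p(V)² ≢ 1 (mod p)` (the unit root `α ≡ a_p(V)` satisfies
`α² ≢ 1`, i.e. the two characters of `(ρ̄_E|G_{ℚ_p})^ss` do not differ by `χ̄_cyc^{±1}`). Decidable from the curve. Source: Fouquet–Wan Thm. 1.1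
(arXiv:2107.13726 p. 2; PREPRINT), second hypothesis. [predicate; nothing asserted] -/
def LanglandsGenericAt (W : WeierstrassCurve ℚ) (p : ℕ) [Fact p.Prime] : Prop :=
  ∀ (V : WeierstrassCurve ℚ) [V.IsElliptic] [V.IsGloballyMinimal] (C : VariableChange ℚ),
    C • V.quadraticTwist ((-1 : ℚ) ^ (p / 2) * p) = W → V.HasGoodReductionAtPrime p →
      ¬ (p : ℤ) ∣ V.frobeniusTrace p ^ 2 - 1

/-- **(Steinberg) prime, LITERAL reading** — Fouquet–Wan Thm 1.1's third hypothesis on `E` (globally minimal `W`): a prime `ℓ ≠ p` with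
`ℓ ∥ N` (multiplicative reduction), `dim ρ̄^{I_ℓ} = 1` (`ρ̄_{E,p}` ramified at `ℓ`: `p ∤ v_ℓ(Δ_min)`, Skinner–Urban's clause) and `ρ̄^{G_ℓ} = 0`
(Frobenius acts non-trivially on the inertia-invariant line: `ℓ ≢ 1 (mod p)` if split, `ℓ ≢ −1 (mod p)` if non-split). ANY split type,
`ℓ = 2` allowed. Sources: Fouquet–Wan Thm. 1.1 (arXiv:2107.13726 p. 2; PREPRINT), third hypothesis; Skinner–Urban 2014 Thm. 3.6.4 (the
ramification clause). [predicate; nothing asserted] -/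
def SteinbergPrimeAt (W : WeierstrassCurve ℚ) [W.IsGloballyMinimal] (p ℓ : ℕ) [Fact ℓ.Prime] : Prop :=
  ℓ ≠ p ∧ W.HasMultiplicativeReductionAtPrime ℓ ∧ ¬ p ∣ padicValInt ℓ W.minimalDiscriminantInt ∧
    (W.HasSplitMultiplicativeReductionAtPrime ℓ → ¬ p ∣ ℓ - 1) ∧
    (¬ W.HasSplitMultiplicativeReductionAtPrime ℓ → ¬ p ∣ ℓ + 1)

/-- **(Steinberg) prime, CONSERVATIVE reading** (the authors' gloss «`π(f)_ℓ` special Steinberg twisted by the unramified character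
`ℓ ↦ (−1)ℓ^{k/2−1}`», i.e. `a_ℓ = −1`, NON-split multiplicative — the convention of the cell's typed CLW/Wan facts — together with the literal
`G_ℓ`-invariant clause): the line's Wan prime of record (`q ≠ p, 2`, non-split, `p ∤ v_q(Δ_min)`) with `p ∤ q + 1`. Source: Fouquet–Wan
Thm. 1.1 (arXiv:2107.13726 p. 2, gloss at L16; PREPRINT). [predicate; nothing asserted] -/
def SteinbergPrimeNonsplitAt (W : WeierstrassCurve ℚ) [W.IsGloballyMinimal] (p ℓ : ℕ) [Fact ℓ.Prime] : Prop :=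
  WanPrime W p ℓ ∧ ¬ p ∣ ℓ + 1

/-- **THE DOOR-F SUB-ROW of the rank-zero line (crux 19357 `GordTwoRankZeroOffCaseOne`), literal reading**: `p ≥ 5`, `ρ̄_{E,p}` irreducible,
(Langlands), a literal (Steinberg) prime. NO clause on the other additive primes of `E`, NO Tamagawa clause, split Steinberg primes allowed.
Census (e23, Cremona `N < 5·10^5`, r0 universe 39 800): 27 167 rows = 68.3 %, of which 15 027 beyond the members of record.
Source: Fouquet–Wan Cor. 1.10 (arXiv:2107.13726 p. 6; PREPRINT). [predicate; nothing asserted] -/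
def FouquetWanRowR0 (W : WeierstrassCurve ℚ) [W.IsGloballyMinimal] (p : ℕ) [Fact p.Prime] : Prop :=
  5 ≤ p ∧ Irr W p ∧ LanglandsGenericAt W p ∧ ∃ ℓ : ℕ, ∃ _ : Fact ℓ.Prime, SteinbergPrimeAt W p ℓ

/-- **THE DOOR-F SUB-ROW, conservative reading** (non-split odd Steinberg prime with `p ∤ ℓ + 1`). Census (e23): 17 186 rows = 43.2 %, of which
7 370 beyond the members of record. Source: Fouquet–Wan Cor. 1.10 (arXiv:2107.13726 p. 6; PREPRINT). [predicate; nothing asserted] -/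
def FouquetWanRowR0Nonsplit (W : WeierstrassCurve ℚ) [W.IsGloballyMinimal] (p : ℕ) [Fact p.Prime] : Prop :=
  5 ≤ p ∧ Irr W p ∧ LanglandsGenericAt W p ∧ ∃ ℓ : ℕ, ∃ _ : Fact ℓ.Prime, SteinbergPrimeNonsplitAt W p ℓ

variable {W : WeierstrassCurve ℚ} [W.IsGloballyMinimal] {p : ℕ} [Fact p.Prime]

omit [Fact p.Prime] in
/-- The conservative Steinberg prime is a literal one (the split branch is vacuous). Bookkeeping. [folklore] -/
theorem steinbergPrimeAt_of_nonsplit {ℓ : ℕ} [Fact ℓ.Prime] (h : SteinbergPrimeNonsplitAt W p ℓ) :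
    SteinbergPrimeAt W p ℓ := by
  obtain ⟨⟨hℓp, _, hmult, hns, hram⟩, hℓ1⟩ := h
  exact ⟨hℓp, hmult, hram, fun hs ↦ absurd hs hns, fun _ ↦ hℓ1⟩

/-- The conservative door-F sub-row lies inside the literal one. Bookkeeping. [folklore] -/
theorem fouquetWanRowR0_of_nonsplit (h : FouquetWanRowR0Nonsplit W p) : FouquetWanRowR0 W p := by
  obtain ⟨hp5, hirr, hlan, ℓ, hℓ, hst⟩ := h
  exact ⟨hp5, hirr, hlan, ℓ, hℓ, steinbergPrimeAt_of_nonsplit hst⟩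

omit [Fact p.Prime] in
/-- A conservative Steinberg prime is in particular a Wan prime of the line of record (so the three-field FIELD supply at `q := ℓ` is
available to the glue if wanted). Bookkeeping. [folklore] -/
theorem wanPrime_of_steinbergPrimeNonsplitAt {ℓ : ℕ} [Fact ℓ.Prime] (h : SteinbergPrimeNonsplitAt W p ℓ) :
    WanPrime W p ℓ := h.1

/-! ### The glue: the cell on the door-F sub-row, modulo the typed PREPRINT reading (for the LEAD to land after the door-D frame) -/

/-- **DOOR F, rank zero, literal sub-row — CLOSED MODULO THE PREPRINT READING.** For `E/ℚ` (globally minimal `W`) of analytic rank `0` on the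
cell (G-ord, `e = 2`) at `p` and on `FouquetWanRowR0 W p` (`p ≥ 5`, `ρ̄_{E,p}` irreducible, (Langlands), a literal (Steinberg) prime),
`ord_p #Ш(E)_an ≤ ord_p #Ш(E)` — ONE application of the typed reading of Fouquet–Wan (PREPRINT arXiv:2107.13726, 2021; no journal record as of
2026-08-31) Thm 1.1 + Cor 1.10, `FouquetWan2021.cor110_missingLowerBoundAt_rankZero_additiveTwistType` (wi-101363), taken as a HYPOTHESIS: the cell
gives `E` additive at the place of `𝓞 ℚ` over `p` (`Additive.hasAdditiveReductionAt_of_addv`) and the good(-ordinary) twist model `W = C • V^{(p*)}`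
(`TypeGOrd.exists_goodOrd_pStar_twist_model`); (irr), (Langlands), (Steinberg) are the row. Booked ONLY in the separate column «r₀ modulo PREPRINT
(door F)» (director-bsd (776)(iii)). [cite: FouquetWan2021, Thm. 1.1 (p. 2) + Cor. 1.10 (p. 6) (arXiv:2107.13726 v3) — PREPRINT] -/
theorem missingLowerBoundAt_rankZero_fouquetWan
    (hFW : FouquetWan2021.cor110_missingLowerBoundAt_rankZero_additiveTwistType)
    (W : WeierstrassCurve ℚ) [W.IsElliptic] [W.IsGloballyMinimal] (p : ℕ) [hp : Fact p.Prime]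
    (hr : W.analyticRank = 0) (hcell : N10.CellGordTwo W p) (hrow : FouquetWanRowR0 W p) :
    MissingLowerBoundAt W p := by
  obtain ⟨hp2, hadd, hG, he⟩ := hcell
  obtain ⟨hp5, hirr, hLG, ℓ, hℓ, hSt⟩ := hrow
  obtain ⟨V, iV, iVm, C, hord, hC⟩ := TypeGOrd.exists_goodOrd_pStar_twist_model W p hp2 hG hadd he
  exact hFW W p ((primesEquiv (R := 𝓞 ℚ)).symm ⟨p, hp.out⟩) hp5 hr hirr
    (fun V' _ _ C' hC' hgood ↦ hLG V' C' hC' hgood)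
    (natCast_mem_asIdeal_of_primesEquiv_eq (Additive.primesEquiv_symm_apply_coe p))
    (Additive.hasAdditiveReductionAt_of_addv W p hadd) ⟨V, iV, iVm, C, hC, hord.1⟩ ⟨ℓ, hℓ, hSt⟩

/-- **DOOR F, rank zero, conservative sub-row** (non-split odd Steinberg prime = the line's Wan prime with `p ∤ ℓ + 1`) — corollary.
[cite: FouquetWan2021, Thm. 1.1 (p. 2) + Cor. 1.10 (p. 6) (arXiv:2107.13726 v3) — PREPRINT] -/
theorem missingLowerBoundAt_rankZero_fouquetWan_nonsplit
    (hFW : FouquetWan2021.cor110_missingLowerBoundAt_rankZero_additiveTwistType)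
    (W : WeierstrassCurve ℚ) [W.IsElliptic] [W.IsGloballyMinimal] (p : ℕ) [Fact p.Prime]
    (hr : W.analyticRank = 0) (hcell : N10.CellGordTwo W p) (hrow : FouquetWanRowR0Nonsplit W p) :
    MissingLowerBoundAt W p :=
  missingLowerBoundAt_rankZero_fouquetWan hFW W p hr hcell (fouquetWanRowR0_of_nonsplit hrow)

end Summit.BirchSwinnertonDyer.BirchSwinnertonDyer.Theorems.FouquetWanRoad

end
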